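import Summits.HubbardSuperconductivity.HubbardSuperconductivity.Theorems.SoloBlindCertificateFromGroundGap
import HarnessLib

/-!
# d-wave order on the whole ground multiplet caps the gap above it

A quantitative companion of `SoloBlindOrderNotEnergyRobust` and of the variational blueprint
(`SoloBlindTrialSubspaceTransfer`): the blueprint prices a constructive proof of the summit by
the ratio `η_L / γ_L`, where `γ_L` is the gap of `H_L` above its ground eigenspace `V_L` INSIDE the
doped `S^z = 0` sector. This file proves that the summit's own conclusion forces `γ_L = O(|t|)`
uniformly in `L` AND in `U`:

* `gap_le_of_groundState_dWave_order` — Hubbard torus, any `t, U`, any sector `(N, S^z)`, side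
  `L = n+1 ≥ ⌊1600/c⌋ + 4`. If every ground state `φ` of the sector has d-wave order
  `cL⁴‖φ‖² ≤ ‖√2Δ_d φ‖²`, then every variational gap `γ` above the ground eigenspace inside the
  sector obeys `γ ≤ 8π²|t|(M²+M)(1600+2c)/c`, `M = ⌊1600/c⌋ + 1` — a bound `K(c)|t|`
  independent of `L`, `U`, `N`.
* `gap_bounded_of_hubbardSuperconductivity` — hence `HubbardSuperconductivity` implies: for its
  `U, δ` there are `K` and `L₀` with `γ ≤ K` for every gap `γ` above the ground multiplet of the
  doped `S^z = 0` sector at every even `L ≥ L₀`.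

Proof. Take the twisted ground state `φ = W_m† ψ` of `exists_twist_low_energy_small_order`
(`1 ≤ m ≤ M`): it lies in the sector, has energy `≤ E₀ + 8π²|t|(M²+M)` and order `≤ 400L⁴/M <
(c/4)L⁴`. Split `φ = u + w` along the ground eigenspace (`exists_eigen_add_orthogonal`). Order is
a quadratic form bounded by `400L⁴` (`pairField_order_le`), so
`(c/2)L⁴‖u‖² - 400L⁴‖w‖² ≤ order(φ) < (c/4)L⁴`, whence `‖w‖² ≥ c/(1600+2c)`; and the energy
above `E₀` is carried by `w` alone (`re_energy_above_eigen_add_orthogonal`), so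
`γ‖w‖² ≤ 8π²|t|(M²+M)`.

Reading (obstruction report §5.5). Combined with the blueprint (`1600 η_L ≤ c γ_L`), any
variational proof of the summit must produce trial states whose TOTAL energy error is at most
`(c/1600)·K(c)·|t|` — an `L`-independent constant — while `E₀ ~ -|t|L²`; physically the phase
(Anderson–Bogoliubov) mode makes `γ_L ~ |t|/L`, which is stronger but not proved here.
References: E. H. Lieb, *Phys. Rev. Lett.* 62 (1989) 1201 (the only controlled uniqueness
statement, at half filling); P. W. Anderson, *Phys. Rev.* 112 (1958) 1900 (phase mode).
-/

namespace Summit.HubbardSuperconductivity.HubbardSuperconductivity.Theorems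

open Matrix Finset Literature.Probability.LatticeModels
  Literature.MathematicalPhysics.QuantumLattice Literature.MathematicalPhysics.QuantumFieldTheory
  GaugeTwist WithLp
open scoped ComplexConjugate ComplexOrder

/-- **d-wave order on every ground state caps the gap above the ground eigenspace.** Hubbard torus
`H = hubbardTorus 2 (n+1) t U`, sector `S = szSector N Mz` containing a ground state `ψ`, ground
energy `E₀ = minEnergyOn H S`, side `n + 1 ≥ ⌊1600/c⌋ + 4`. If every ground state `φ` of the
sector satisfies `c(n+1)⁴‖φ‖² ≤ re⟨φ, (√2Δ_d)†(√2Δ_d) φ⟩`, and `γ` is a variational gap above the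
ground eigenspace inside `S` (`γ‖w‖² ≤ re⟨w,Hw⟩ - E₀‖w‖²` for `w ∈ S` orthogonal to all ground
states), then `γ ≤ 8π²|t|(M²+M)·(1600+2c)/c` with `M = ⌊1600/c⌋ + 1`. [this work] -/
theorem gap_le_of_groundState_dWave_order {t U c γ : ℝ} (hc : 0 < c) {n : ℕ}
    (hn : ⌊1600 / c⌋₊ + 4 ≤ n + 1) {N : ℕ} {Mz : ℝ} {ψ : Fock (Orb (FermionTorus 2 (n + 1)))}
    (hψ : IsGroundStateInSector (hubbardTorus 2 (n + 1) t U) N Mz ψ)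
    (hord : ∀ φ, IsGroundStateInSector (hubbardTorus 2 (n + 1) t U) N Mz φ →
      c * ((n + 1 : ℕ) : ℝ) ^ 4 * (star φ ⬝ᵥ φ).re ≤
        (expect ((pairField dWaveFormFactor (n + 1))ᴴ * pairField dWaveFormFactor (n + 1)) φ).re)
    (hgap : ∀ w ∈ szSector (Λ := FermionTorus 2 (n + 1)) N Mz,
      (∀ φ, IsGroundStateInSector (hubbardTorus 2 (n + 1) t U) N Mz φ → star φ ⬝ᵥ w = 0) →
        γ * (star w ⬝ᵥ w).re ≤ (star w ⬝ᵥ (hubbardTorus 2 (n + 1) t U *ᵥ w)).re -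
          (hubbardTorus 2 (n + 1) t U).minEnergyOn (szSector N Mz) * (star w ⬝ᵥ w).re) :
    γ ≤ 8 * Real.pi ^ 2 * |t| * (((⌊1600 / c⌋₊ + 1 : ℕ) : ℝ) ^ 2 + (⌊1600 / c⌋₊ + 1 : ℕ)) *
      ((1600 + 2 * c) / c) := by
  classical
  set H := hubbardTorus 2 (n + 1) t U with hH
  set E₀ := H.minEnergyOn (szSector N Mz) with hE₀
  set M : ℕ := ⌊1600 / c⌋₊ + 1 with hM
  set e : ℝ := 8 * Real.pi ^ 2 * |t| * ((M : ℝ) ^ 2 + M) with he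
  have he0 : 0 ≤ e := by positivity
  by_cases hγ : 0 ≤ γ
  swap
  · exact (le_of_lt (not_le.mp hγ)).trans (by positivity)
  -- normalise the ground state
  obtain ⟨a, ha0, -, ha1⟩ := EigenvalueContinuation.exists_normalize hψ.2.1
  set ψ₁ : Fock (Orb (FermionTorus 2 (n + 1))) := (a : ℂ) • ψ with hψ₁
  have hψ₁gs : IsGroundStateInSector H N Mz ψ₁ := by
    refine ⟨(szSector N Mz).smul_mem _ hψ.1, ?_, ?_⟩
    · intro h0
      rw [h0] at ha1
      simp at ha1
    · rw [hψ₁, mulVec_smul, hψ.2.2, smul_comm]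
  -- a twisted ground state: in the sector, energy `≤ E₀ + e`, order `≤ 400L⁴/M`
  have hM1 : 1 ≤ M := by omega
  have hML : M < n + 1 := by omega
  obtain ⟨φ, hφS, hφ1, hE, hO⟩ := GaugeTwist.exists_twist_low_energy_small_order (L := n + 1)
    (by omega) t U hψ₁gs ha1 dWaveFormFactor GaugeTwist.abs_dWaveFormFactor_le_one hM1 hML
  -- split `φ = u + w` along the ground eigenspace
  obtain ⟨u, w, hφuw, huS, hu, hwS, hw⟩ := exists_eigen_add_orthogonal H (szSector N Mz) E₀ hφS
  have huw : star u ⬝ᵥ w = 0 := hw u huS hu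
  have hwgs : ∀ φ', IsGroundStateInSector H N Mz φ' → star φ' ⬝ᵥ w = 0 :=
    fun φ' h' => hw φ' h'.1 h'.2.2
  -- norms: `‖u‖² + ‖w‖² = 1`
  have hnorm : (star u ⬝ᵥ u).re + (star w ⬝ᵥ w).re = 1 := by
    have h := re_add_self_of_orthogonal u w (by rw [huw, Complex.zero_re])
    rw [← hφuw, hφ1, Complex.one_re] at h
    exact h.symm
  have hure := (Complex.nonneg_iff.mp (dotProduct_star_self_nonneg u)).1
  have hwre := (Complex.nonneg_iff.mp (dotProduct_star_self_nonneg w)).1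
  -- energy: `γ‖w‖² ≤ e`
  have hγw : γ * (star w ⬝ᵥ w).re ≤ e := by
    have h1 := hgap w hwS hwgs
    have h2 := re_energy_above_eigen_add_orthogonal (isHermitian_hubbardTorus (n + 1) t U) u w E₀
      hu huw
    rw [← hφuw, hφ1, Complex.one_re, mul_one] at h2
    linarith
  -- order: `c L⁴‖u‖²/2 - 400 L⁴‖w‖² ≤ order φ ≤ 400 L⁴/M < (c/4) L⁴`
  set Δ := pairField dWaveFormFactor (n + 1) with hΔ
  set P : ℝ := ((n + 1 : ℕ) : ℝ) ^ 4 with hP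
  have hP0 : 0 < P := by positivity
  have hqu : c * P * (star u ⬝ᵥ u).re ≤ (star (Δ *ᵥ u) ⬝ᵥ (Δ *ᵥ u)).re := by
    by_cases hu0 : u = 0
    · rw [hu0]; simp
    · have h := hord u ⟨huS, hu0, hu⟩
      rwa [PosSemidefTrace.expect_conjTranspose_mul] at h
  have hqw : (star (Δ *ᵥ w) ⬝ᵥ (Δ *ᵥ w)).re ≤ 400 * P * (star w ⬝ᵥ w).re := by
    have := pairField_order_le (L := n + 1) dWaveFormFactor GaugeTwist.abs_dWaveFormFactor_le_one w
    simpa [hP] using this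
  have hqφ : (star (Δ *ᵥ φ) ⬝ᵥ (Δ *ᵥ φ)).re ≤ 400 * P / M := by
    rw [← PosSemidefTrace.expect_conjTranspose_mul]
    simpa [hP] using hO
  have hhalf := half_re_self_sub_le_re_add_self (Δ *ᵥ u) (Δ *ᵥ w)
  rw [← mulVec_add, ← hφuw] at hhalf
  have hM0 : (0 : ℝ) < M := by exact_mod_cast hM1
  have hcM : 1600 < c * M := by
    have hlt : 1600 / c < M := by rw [hM]; push_cast; exact Nat.lt_floor_add_one _
    rwa [div_lt_iff₀ hc, mul_comm] at hlt
  -- `400 P / M < (c/4) P`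
  have hPM : 400 * P / M < c / 4 * P := by
    rw [div_lt_iff₀ hM0]
    nlinarith
  -- hence `(c/2 + 400)‖w‖² > c/4`, i.e. `‖w‖² ≥ c/(1600+2c)` (after dividing by `P`)
  have h5 : c * P * (star u ⬝ᵥ u).re / 2 - 400 * P * (star w ⬝ᵥ w).re < c / 4 * P := by
    linarith
  have h6 : c * P * (star u ⬝ᵥ u).re = c * P * (1 - (star w ⬝ᵥ w).re) := by
    rw [← hnorm]; ring
  have hkey : c / 4 * P < (c / 2 + 400) * P * (star w ⬝ᵥ w).re := by linarith
  have hθ : c / (1600 + 2 * c) ≤ (star w ⬝ᵥ w).re := by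
    rw [div_le_iff₀ (by positivity)]
    by_contra hlt
    have hlt' : (star w ⬝ᵥ w).re * (1600 + 2 * c) < c := not_le.mp hlt
    nlinarith
  have hθ0 : 0 < c / (1600 + 2 * c) := by positivity
  calc γ ≤ e / (c / (1600 + 2 * c)) := by
        rw [le_div_iff₀ hθ0]
        exact (mul_le_mul_of_nonneg_left hθ hγ).trans hγw
    _ = e * ((1600 + 2 * c) / c) := by rw [div_div_eq_mul_div, mul_div_assoc]

/-- **Superconducting order forces soft in-sector modes.** If `HubbardSuperconductivity` holds,
then for its `U, δ` there are `K : ℝ` and `L₀` such that at every even side `L = n+1 ≥ L₀`, every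
variational gap `γ` of `hubbardTorus 2 L 1 U` above the ground eigenspace inside the doped
`S^z = 0` sector `(2⌊(1-δ)L²/2⌋, 0)` satisfies `γ ≤ K` (uniformly in `L`). [this work] -/
theorem gap_bounded_of_hubbardSuperconductivity (hS : HubbardSuperconductivity) :
    ∃ U : ℝ, 0 < U ∧ ∃ δ ∈ Set.Ioo (0 : ℝ) (1 / 2), ∃ K : ℝ, ∃ L₀ : ℕ,
      ∀ n : ℕ, Even (n + 1) → L₀ ≤ n + 1 → ∀ γ : ℝ,
        (∀ w ∈ szSector (Λ := FermionTorus 2 (n + 1))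
            (2 * ⌊(1 - δ) * ((n + 1 : ℕ) : ℝ) ^ 2 / 2⌋₊) 0,
          (∀ ψ, IsGroundStateInSector (hubbardTorus 2 (n + 1) 1 U)
              (2 * ⌊(1 - δ) * ((n + 1 : ℕ) : ℝ) ^ 2 / 2⌋₊) 0 ψ → star ψ ⬝ᵥ w = 0) →
          γ * (star w ⬝ᵥ w).re ≤ (star w ⬝ᵥ (hubbardTorus 2 (n + 1) 1 U *ᵥ w)).re -
            (hubbardTorus 2 (n + 1) 1 U).minEnergyOn
              (szSector (2 * ⌊(1 - δ) * ((n + 1 : ℕ) : ℝ) ^ 2 / 2⌋₊) 0) * (star w ⬝ᵥ w).re) →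
        γ ≤ K := by
  obtain ⟨U, hU, δ, hδ, c, hc, L₀, hb⟩ := uniform_dWave_bound_of_hubbardSuperconductivity hS
  refine ⟨U, hU, δ, hδ,
    8 * Real.pi ^ 2 * |(1 : ℝ)| * (((⌊1600 / c⌋₊ + 1 : ℕ) : ℝ) ^ 2 + (⌊1600 / c⌋₊ + 1 : ℕ)) *
      ((1600 + 2 * c) / c), max L₀ (⌊1600 / c⌋₊ + 4), fun n hn hL γ hgap => ?_⟩
  obtain ⟨ψ, -, hψ⟩ :=
    InfVolFermionState.exists_unit_isGroundStateInSector_rectN (1 : ℝ) U (n := 1 - δ)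
      (by linarith [hδ.1]) (n + 1)
  have hψ' : IsGroundStateInSector (hubbardTorus 2 (n + 1) 1 U)
      (2 * ⌊(1 - δ) * ((n + 1 : ℕ) : ℝ) ^ 2 / 2⌋₊) 0 ψ := by
    simpa [ThermodynamicLimit.rectN] using hψ
  refine gap_le_of_groundState_dWave_order hc (le_of_max_le_right hL) hψ' (fun φ hφ => ?_) hgap
  -- the homogeneous order bound from the unit one
  obtain ⟨a, ha0, haa, ha1⟩ := EigenvalueContinuation.exists_normalize hφ.2.1
  have hgs : IsGroundStateInSector (hubbardTorus 2 (n + 1) 1 U)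
      (2 * ⌊(1 - δ) * ((n + 1 : ℕ) : ℝ) ^ 2 / 2⌋₊) 0 ((a : ℂ) • φ) := by
    refine ⟨Submodule.smul_mem _ _ hφ.1, ?_, by rw [mulVec_smul, hφ.2.2, smul_comm]⟩
    intro h0
    rw [h0] at ha1
    simp at ha1
  have h := hb n hn (le_of_max_le_left hL) _ ha1 hgs
  have hsa : star (a : ℂ) * (a : ℂ) = ((a * a : ℝ) : ℂ) := by
    rw [Complex.star_def, Complex.conj_ofReal]; push_cast; ring
  rw [PosSemidefTrace.expect_conjTranspose_mul, mulVec_smul, star_smul, smul_dotProduct,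
    dotProduct_smul, smul_smul, hsa, smul_eq_mul, Complex.re_ofReal_mul] at h
  have hr := (Complex.nonneg_iff.mp (dotProduct_star_self_nonneg φ)).1
  rw [PosSemidefTrace.expect_conjTranspose_mul]
  calc c * ((n + 1 : ℕ) : ℝ) ^ 4 * (star φ ⬝ᵥ φ).re
      ≤ a * a * (star (pairField dWaveFormFactor (n + 1) *ᵥ φ) ⬝ᵥ
          (pairField dWaveFormFactor (n + 1) *ᵥ φ)).re * (star φ ⬝ᵥ φ).re :=
        mul_le_mul_of_nonneg_right h hr
    _ = (star (pairField dWaveFormFactor (n + 1) *ᵥ φ) ⬝ᵥ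
          (pairField dWaveFormFactor (n + 1) *ᵥ φ)).re * (a * a * (star φ ⬝ᵥ φ).re) := by ring
    _ = _ := by rw [haa, mul_one]

end Summit.HubbardSuperconductivity.HubbardSuperconductivity.Theorems
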